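import Literature.Computability.Cryptography.HallgrenClassGroupComposition
import Literature.Computability.Cryptography.HallgrenClassGroupReduction
import Literature.NumberTheory.QuadraticFields.DedekindZetaReducedForms
import HarnessLib

/-!
# Hallgren 2005 / class numbers under GRH — step Q1c: composition of forms (the group law on
# reduced forms of discriminant `d_K`) and the canonical integral basis `(1, (d_K + √d_K)/2)`

Topic `Literature/Computability/Cryptography`; proof companion of `HallgrenClassGroup.lean`
(named fact `Hallgren2005_classNumber_qsolvable_of_GRH`). Real definitions (with bodies) and
theorems; no named fact.

The class-number algorithm computes in `Cl(𝓞_K)`, `K = ℚ(√−d)`, on REDUCED FORMS (unique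
representatives, Cox Thm. 2.8) with the group law "compose, then reduce". This file assembles the
form-level operation from the ideal-level composition (`HallgrenClassGroupComposition.lean`:
`𝔞₁𝔞₂ = (d)·(A, ω − k₃)`) and the reduction algorithm (`HallgrenClassGroupReduction.lean`):

* the canonical field data `mOf D = (D − D²)/4` (so that `ω = (D + √D)/2` satisfies
  `ω² = mOf D + D ω`) and `kOf D f = (b + D)/2` (the form ideal of `f = (a, b, c)` is
  `(a, ω − kOf D f)`); `exists_basis_canonical` — **an integral basis `(1, ω)` of `𝓞 K` with
  `ω² = mOf d_K + d_K ω` exists** (shear any basis `(1, ω')`, `HeegnerCondition.exists_basis_zero_eq_one`);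
* `rawCompose D f g = (A, 2k₃ − D, (k₃² − D k₃ − mOf D)/A)` and **`compose D f g = reduce (rawCompose D f g)`**
  — THE ALGORITHM (integer arithmetic only: extended gcds and a logarithmic number of Gauss steps);
* `isPosPrim_rawCompose`, `isPosPrim_compose`, `isReduced_compose`, `compose_mem_reducedForms`;
* `mk0_formIdeal_eq_of_properEquiv` — properly equivalent forms have the same ideal class
  (tree: `isGamma0Equiv_one_of_properEquiv`, `exists_span_mul_formIdeal_eq_of_isGamma0Equiv`);
* **`mk0_formIdeal_compose`** — `[𝔞_{compose f g}] = [𝔞_f] · [𝔞_g]` in `Cl(𝓞_K)`.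

## References

* D. A. Cox, *Primes of the form x² + ny²*, 2nd ed. (2013), §3.A, Thm. 2.8, §7.B Thm. 7.7 [Cox2013].
* A. M. Childs, W. van Dam, Rev. Mod. Phys. 82 (2010), §5.7 [ChildsVandam2010].
-/

noncomputable section

open scoped nonZeroDivisors

namespace Literature.Computability.Cryptography.Hallgren2005

namespace FormComposition

open Module NumberField
open Literature.NumberTheory.QuadraticFields.Quadratic Literature.NumberTheory.QuadraticFields.Quadratic.BinQF
open Literature.NumberTheory.EllipticCurves Composition Reduction
open Literature.NumberTheory.QuadraticFields.BinaryQuadraticForm (reducedForms)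

/-! ### Canonical field data -/

/-- `m(D) = (D − D²)/4`, so that `ω = (D + √D)/2` satisfies `ω² = m(D) + D ω`. [folklore] -/
def mOf (D : ℤ) : ℤ := (D - D ^ 2) / 4

/-- `k(f) = (b + D)/2`: the form ideal of `f = (a, b, c)` is `(a, ω − k(f))`, `ω = (D + √D)/2`.
[cite: Cox2013, §7.B Thm. 7.7 (the ideal [a, (−b + √D)/2])] -/
def kOf (D : ℤ) (f : BinQF) : ℤ := (f.b + D) / 2

/-- `4 m(D) = D − D²` for `D ≡ 0, 1 (mod 4)`. [folklore] -/
theorem four_mul_mOf {D : ℤ} (hD4 : D % 4 = 0 ∨ D % 4 = 1) : 4 * mOf D = D - D ^ 2 := by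
  rw [mOf]
  have hq := Int.emod_def D 4
  have h : 4 ∣ D - D ^ 2 := by
    rcases hD4 with h0 | h1
    · refine ⟨D / 4 - 4 * (D / 4) ^ 2, ?_⟩
      have hD : D = 4 * (D / 4) := by linarith
      conv_lhs => rw [hD]
      ring
    · refine ⟨-(4 * (D / 4) ^ 2 + D / 4), ?_⟩
      have hD : D = 4 * (D / 4) + 1 := by linarith
      conv_lhs => rw [hD]
      ring
  exact Int.mul_ediv_cancel' h

/-- `D² + 4 m(D) = D`. [folklore] -/
theorem sq_add_four_mul_mOf {D : ℤ} (hD4 : D % 4 = 0 ∨ D % 4 = 1) : D ^ 2 + 4 * mOf D = D := by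
  linarith [four_mul_mOf hD4]

/-- `2 k(f) = b + D` when `disc f = D` (`b ≡ D (mod 2)`). [folklore] -/
theorem two_mul_kOf {D : ℤ} {f : BinQF} (hf : f.disc = D) : 2 * kOf D f = f.b + D := by
  rw [kOf]
  have h : 2 ∣ f.b + D := by
    rw [← hf, disc]
    rcases Int.even_or_odd f.b with ⟨r, hr⟩ | ⟨r, hr⟩
    · exact ⟨r + 2 * r ^ 2 - 2 * f.a * f.c, by rw [hr]; ring⟩
    · exact ⟨2 * r ^ 2 + 3 * r + 1 - 2 * f.a * f.c, by rw [hr]; ring⟩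
  exact Int.mul_ediv_cancel' h

/-- **The norm relation** `a c = k² − D k − m(D)` for a form of discriminant `D` (the hypothesis
`hn` of the ideal-level files, with `t = D`, `m = m(D)`, `k = k(f)`). [cite: Cox2013, §7.B Thm. 7.7] -/
theorem norm_eq {D : ℤ} {f : BinQF} (hf : f.disc = D) (hD4 : D % 4 = 0 ∨ D % 4 = 1) :
    f.a * f.c = kOf D f ^ 2 - D * kOf D f - mOf D := by
  have h2 := two_mul_kOf hf
  have h4 := four_mul_mOf hD4
  have hd : f.b ^ 2 - 4 * f.a * f.c = D := hf
  have hb : f.b = 2 * kOf D f - D := by linarith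
  rw [hb] at hd
  have h4ac : 4 * (f.a * f.c) = 4 * (kOf D f ^ 2 - D * kOf D f - mOf D) := by
    linear_combination (-1 : ℤ) * hd + h4
  linarith

/-- The middle coefficient from `k`: `b = 2 k(f) − D`. [folklore] -/
theorem b_eq_two_mul_kOf_sub {D : ℤ} {f : BinQF} (hf : f.disc = D) : f.b = 2 * kOf D f - D := by
  linarith [two_mul_kOf hf]

/-! ### The canonical integral basis -/

/-- **An integral basis `(1, ω)` with `ω² = m(d_K) + d_K ω`** (i.e. `ω = (d_K + √d_K)/2`): shear an
integral basis `(1, ω')`, `ω'² = m' + t'ω'`, `d_K = t'² + 4m'`, to `ω = ω' + (d_K − t')/2`.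
[folklore] -/
theorem exists_basis_canonical {K : Type*} [Field K] [NumberField K] (h2 : finrank ℚ K = 2) :
    ∃ b : Basis (Fin 2) ℤ (𝓞 K), b 0 = 1 ∧
      b 1 * b 1 = (mOf (NumberField.discr K) : 𝓞 K) + (NumberField.discr K : 𝓞 K) * b 1 := by
  obtain ⟨e, he⟩ := exists_basis_zero_eq_one (K := K) h2
  set m' : ℤ := e.repr (e 1 * e 1) 0 with hm'
  set t' : ℤ := e.repr (e 1 * e 1) 1 with ht'
  have hω' : e 1 * e 1 = (m' : 𝓞 K) + (t' : 𝓞 K) * e 1 := basis_one_mul_self_eq e he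
  have hDK : NumberField.discr K = t' ^ 2 + 4 * m' := discr_eq_sq_add_four_mul e he
  set D : ℤ := NumberField.discr K with hDdef
  -- the shear parameter `n = (D − t')/2`
  have h2n : 2 ∣ D - t' := by
    rw [hDK]
    rcases Int.even_or_odd t' with ⟨r, hr⟩ | ⟨r, hr⟩
    · exact ⟨2 * r ^ 2 + 2 * m' - r, by rw [hr]; ring⟩
    · exact ⟨2 * r ^ 2 + r + 2 * m', by rw [hr]; ring⟩
  set n : ℤ := (D - t') / 2 with hn
  have h2n' : 2 * n = D - t' := Int.mul_ediv_cancel' h2n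
  have hD4 : D % 4 = 0 ∨ D % 4 = 1 := by
    rw [hDK]
    rcases Int.even_or_odd t' with ⟨r, hr⟩ | ⟨r, hr⟩
    · left
      have : t' ^ 2 + 4 * m' = 4 * (r ^ 2 + m') := by rw [hr]; ring
      omega
    · right
      have : t' ^ 2 + 4 * m' = 4 * (r ^ 2 + r + m') + 1 := by rw [hr]; ring
      omega
  have h4m := four_mul_mOf hD4
  -- the new basis `(1, ω' + n)` has coordinate matrix of determinant `1`
  set ω : 𝓞 K := e 1 + (n : 𝓞 K) with hω
  set w : Fin 2 → 𝓞 K := ![1, ω] with hw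
  have hrepr1 : e.repr 1 = Finsupp.single 0 1 := by rw [← he, e.repr_self]
  have hdet : e.det w = 1 := by
    rw [e.det_apply, Matrix.det_fin_two]
    simp only [e.toMatrix_apply, hw, Matrix.cons_val_zero, Matrix.cons_val_one]
    have hωrepr : e.repr ω = Finsupp.single 1 1 + n • Finsupp.single 0 1 := by
      rw [hω, map_add, e.repr_self, show ((n : ℤ) : 𝓞 K) = n • (1 : 𝓞 K) by simp, map_zsmul, hrepr1]
    rw [hrepr1, hωrepr]
    simp
  obtain ⟨hli, hsp⟩ := (Module.Basis.is_basis_iff_det e).mpr (hdet ▸ isUnit_one)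
  refine ⟨Basis.mk hli hsp.ge, by simp [hw], ?_⟩
  simp only [Basis.mk_apply, hw, Matrix.cons_val_one, Matrix.cons_val_zero]
  -- `ω² = m(D) + D ω`
  have hcast2 : ((2 * n : ℤ) : 𝓞 K) = ((D - t' : ℤ) : 𝓞 K) := by rw [h2n']
  have hcast4 : ((4 * mOf D : ℤ) : 𝓞 K) = ((D - D ^ 2 : ℤ) : 𝓞 K) := by rw [h4m]
  have hcastD : ((D : ℤ) : 𝓞 K) = ((t' ^ 2 + 4 * m' : ℤ) : 𝓞 K) := by rw [hDK]
  push_cast at hcast2 hcast4 hcastD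
  rw [hω]
  -- `2` is not a zero divisor in `𝓞 K`; clear denominators by multiplying by `4`
  have key : (4 : 𝓞 K) * ((e 1 + n) * (e 1 + n)) = 4 * ((mOf D : 𝓞 K) + (D : 𝓞 K) * (e 1 + n)) := by
    linear_combination (4 : 𝓞 K) * hω' + (4 * e 1 + 2 * (n : 𝓞 K) - (D : 𝓞 K) - (t' : 𝓞 K)) * hcast2
      - hcast4 - hcastD
  have h4 : (4 : 𝓞 K) ≠ 0 := by
    have : ((4 : ℤ) : 𝓞 K) ≠ 0 := fun h => by
      have := intCast_eq_zero_of_basis e he h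
      norm_num at this
    exact_mod_cast this
  exact mul_left_cancel₀ h4 key

/-! ### The algorithm -/

/-- **Raw composition** (before reduction): `(A, 2k₃ − D, (k₃² − D k₃ − m(D))/A)` with
`A = compA`, `k₃ = compK` computed on the canonical data `t = D`, `m = m(D)`.
[cite: Cox2013, §3.A (composition)] -/
def rawCompose (D : ℤ) (f g : BinQF) : BinQF :=
  ⟨compA D (mOf D) f.a (kOf D f) g.a (kOf D g),
    2 * compK D (mOf D) f.a (kOf D f) g.a (kOf D g) - D,
    (compK D (mOf D) f.a (kOf D f) g.a (kOf D g) ^ 2 -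
        D * compK D (mOf D) f.a (kOf D f) g.a (kOf D g) - mOf D) /
      compA D (mOf D) f.a (kOf D f) g.a (kOf D g)⟩

/-- **Composition of forms**: raw composition followed by Gauss reduction — the group law on the
reduced forms of discriminant `D` used by the class-number algorithm. [cite: Cox2013, §3.A and Thm. 2.8] -/
def compose (D : ℤ) (f g : BinQF) : BinQF := reduce (rawCompose D f g)

/-- `k(rawCompose f g) = compK`. [folklore] -/
theorem kOf_rawCompose (D : ℤ) (f g : BinQF) :
    kOf D (rawCompose D f g) = compK D (mOf D) f.a (kOf D f) g.a (kOf D g) := by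
  simp only [kOf, rawCompose]
  omega

/-! ### Well-formedness -/

section Ring

variable {K : Type*} [Field K] [NumberField K] (b : Basis (Fin 2) ℤ (𝓞 K)) (hb : b 0 = 1)
  (hω : b 1 * b 1 = (mOf (NumberField.discr K) : 𝓞 K) + (NumberField.discr K : 𝓞 K) * b 1)

include hb hω in
/-- **The raw composite is a primitive positive definite form of discriminant `d_K`** (for forms
`f, g` of discriminant `d_K`; positivity and primitivity come from the basis, so no sign hypothesis
on `d_K` is needed here). [cite: Cox2013, §3.A (composition)] -/
theorem isPosPrim_rawCompose {f g : BinQF}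
    (hf : f.IsPosPrim (NumberField.discr K)) (hg : g.IsPosPrim (NumberField.discr K)) :
    (rawCompose (NumberField.discr K) f g).IsPosPrim (NumberField.discr K) := by
  set D := NumberField.discr K with hD
  have hD4 : D % 4 = 0 ∨ D % 4 = 1 := hf.emod_four
  have hn₁ := norm_eq hf.disc_eq hD4
  have hn₂ := norm_eq hg.disc_eq hD4
  have ha₁ := hf.a_pos
  have ha₂ := hg.a_pos
  set A := compA D (mOf D) f.a (kOf D f) g.a (kOf D g) with hA
  set k₃ := compK D (mOf D) f.a (kOf D f) g.a (kOf D g) with hk₃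
  obtain ⟨C₃, hC₃⟩ := compA_dvd b hb hω ha₁.ne' hn₁ hn₂
  rw [← hA, ← hk₃] at hC₃
  have hApos : 0 < A := compA_pos b hb hω ha₁.ne' ha₂.ne' hn₁ hn₂
  have hc : (rawCompose D f g).c = C₃ := by
    show (k₃ ^ 2 - D * k₃ - mOf D) / A = C₃
    rw [hC₃, Int.mul_ediv_cancel_left _ hApos.ne']
  have hdisc : (rawCompose D f g).disc = D := by
    show (2 * k₃ - D) ^ 2 - 4 * A * ((k₃ ^ 2 - D * k₃ - mOf D) / A) = D
    rw [show (k₃ ^ 2 - D * k₃ - mOf D) / A = C₃ from hc]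
    have := sq_add_four_mul_mOf hD4
    nlinarith [hC₃]
  refine ⟨hdisc, hApos, ?_⟩
  -- primitivity: forms of the fundamental discriminant `d_K` are primitive
  rw [BinQF.isPrimitive_iff]
  intro e heA heB heC
  have hdisc' : (rawCompose D f g).b ^ 2 - 4 * (rawCompose D f g).a * (rawCompose D f g).c =
      D ^ 2 + 4 * mOf D := by
    rw [sq_add_four_mul_mOf hD4]; exact hdisc
  exact isUnit_of_dvd_of_disc_eq b hb hω hdisc' heA heB heC

include hb hω in
/-- `compose f g` is a primitive positive definite form of discriminant `d_K`. [cite: Cox2013, §3.A and Thm. 2.8] -/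
theorem isPosPrim_compose (hK : IsImaginaryQuadratic K) {f g : BinQF}
    (hf : f.IsPosPrim (NumberField.discr K)) (hg : g.IsPosPrim (NumberField.discr K)) :
    (compose (NumberField.discr K) f g).IsPosPrim (NumberField.discr K) :=
  isPosPrim_reduce hK.discr_neg (isPosPrim_rawCompose b hb hω hf hg)

include hb hω in
/-- `compose f g` is reduced. [cite: Cox2013, §2.A Thm. 2.8] -/
theorem isReduced_compose (hK : IsImaginaryQuadratic K) {f g : BinQF}
    (hf : f.IsPosPrim (NumberField.discr K)) (hg : g.IsPosPrim (NumberField.discr K)) :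
    (compose (NumberField.discr K) f g).IsReduced :=
  isReduced_reduce hK.discr_neg (isPosPrim_rawCompose b hb hω hf hg)

include hb hω in
/-- `compose f g`, as a triple, is a member of `reducedForms d_K`. [cite: Cox2013, §2.A Thm. 2.13] -/
theorem compose_mem_reducedForms (hK : IsImaginaryQuadratic K) {f g : BinQF}
    (hf : f.IsPosPrim (NumberField.discr K)) (hg : g.IsPosPrim (NumberField.discr K)) :
    ((compose (NumberField.discr K) f g).a, (compose (NumberField.discr K) f g).b,
      (compose (NumberField.discr K) f g).c) ∈ reducedForms (NumberField.discr K) :=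
  reduce_mem_reducedForms hK.discr_neg (isPosPrim_rawCompose b hb hω hf hg)

/-! ### Classes -/

/-- The form ideal `𝔞_f = (a, ω − k(f))` of `f`. [cite: Cox2013, §7.B Thm. 7.7] -/
def formIdeal (f : BinQF) : Ideal (𝓞 K) :=
  Ideal.span {(f.a : 𝓞 K), b 1 - (kOf (NumberField.discr K) f : 𝓞 K)}

include hb in
/-- `𝔞_f` is a non-zero-divisor for `a > 0`. [folklore] -/
theorem formIdeal_mem_nonZeroDivisors {f : BinQF} (ha : 0 < f.a) :
    formIdeal b f ∈ (Ideal (𝓞 K))⁰ :=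
  span_pair_mem_nonZeroDivisors b hb ha.ne' _

include hb hω in
/-- **Properly equivalent forms have the same ideal class**: `[𝔞_f] = [𝔞_{f'}]` for `f ∼ f'`
primitive positive definite of discriminant `d_K` (tree: proper equivalence is `Γ₀(1)`-equivalence
of Heegner points, which gives `x 𝔞_f = y 𝔞_{f'}`). [cite: Cox2013, §7.B Thm. 7.7 (proof, (7.8))] -/
theorem mk0_formIdeal_eq_of_properEquiv (hK : IsImaginaryQuadratic K) {f f' : BinQF}
    (hf : f.IsPosPrim (NumberField.discr K)) (h : f.ProperEquiv f') :
    ClassGroup.mk0 ⟨formIdeal b f, formIdeal_mem_nonZeroDivisors b hb hf.a_pos⟩ =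
      ClassGroup.mk0 ⟨formIdeal b f',
        formIdeal_mem_nonZeroDivisors b hb (h.isPosPrim hK.discr_neg hf).a_pos⟩ := by
  set D := NumberField.discr K with hD
  have hD0 : D < 0 := hK.discr_neg
  have hD4 : D % 4 = 0 ∨ D % 4 = 1 := hf.emod_four
  have hf' := h.isPosPrim hD0 hf
  have hdisc : f.disc < 0 := by rw [hf.disc_eq]; exact hD0
  have hγ := isGamma0Equiv_one_of_properEquiv hf.a_pos hdisc h
  have hneg : D ^ 2 + 4 * mOf D < 0 := by rw [sq_add_four_mul_mOf hD4]; exact hD0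
  have hdf : f.b ^ 2 - 4 * f.a * f.c = D ^ 2 + 4 * mOf D := by rw [sq_add_four_mul_mOf hD4]; exact hf.disc_eq
  have hdf' : f'.b ^ 2 - 4 * f'.a * f'.c = D ^ 2 + 4 * mOf D := by
    rw [sq_add_four_mul_mOf hD4]; exact hf'.disc_eq
  obtain ⟨x, y, hx, hy, hxy⟩ := exists_span_mul_formIdeal_eq_of_isGamma0Equiv b hb hω hneg
    (Q := (f.a, f.b, f.c)) (Q' := (f'.a, f'.b, f'.c)) hf.a_pos hdf hf'.a_pos hdf' hγ
  exact ClassGroup.mk0_eq_mk0_iff.mpr ⟨x, y, hx, hy, hxy⟩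

include hb hω in
/-- **The raw composite represents the product class**: `[𝔞_{rawCompose f g}] = [𝔞_f][𝔞_g]`.
[cite: Cox2013, §7.B Thm. 7.7 and §3.A] -/
theorem mk0_formIdeal_rawCompose {f g : BinQF}
    (hf : f.IsPosPrim (NumberField.discr K)) (hg : g.IsPosPrim (NumberField.discr K)) :
    ClassGroup.mk0 ⟨formIdeal b (rawCompose (NumberField.discr K) f g),
        formIdeal_mem_nonZeroDivisors b hb (isPosPrim_rawCompose b hb hω hf hg).a_pos⟩ =
      ClassGroup.mk0 ⟨formIdeal b f, formIdeal_mem_nonZeroDivisors b hb hf.a_pos⟩ *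
        ClassGroup.mk0 ⟨formIdeal b g, formIdeal_mem_nonZeroDivisors b hb hg.a_pos⟩ := by
  have hD4 : NumberField.discr K % 4 = 0 ∨ NumberField.discr K % 4 = 1 := hf.emod_four
  have hn₁ := norm_eq hf.disc_eq hD4
  have hn₂ := norm_eq hg.disc_eq hD4
  have h := mk0_mul_mk0_eq b hb hω hf.a_pos hg.a_pos hn₁ hn₂
  have hI : formIdeal b (rawCompose (NumberField.discr K) f g) =
      Ideal.span {(compA (NumberField.discr K) (mOf (NumberField.discr K)) f.a
          (kOf (NumberField.discr K) f) g.a (kOf (NumberField.discr K) g) : 𝓞 K),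
        b 1 - (compK (NumberField.discr K) (mOf (NumberField.discr K)) f.a
          (kOf (NumberField.discr K) f) g.a (kOf (NumberField.discr K) g) : 𝓞 K)} := by
    simp only [formIdeal, kOf_rawCompose]
    rfl
  have hsub : (⟨formIdeal b (rawCompose (NumberField.discr K) f g),
      formIdeal_mem_nonZeroDivisors b hb (isPosPrim_rawCompose b hb hω hf hg).a_pos⟩ :
        (Ideal (𝓞 K))⁰) =
      ⟨_, span_pair_mem_nonZeroDivisors b hb
        (compA_pos b hb hω hf.a_pos.ne' hg.a_pos.ne' hn₁ hn₂).ne' _⟩ :=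
    Subtype.ext hI
  rw [hsub, ← h]
  rfl

include hb hω in
/-- **Composition is the group law**: `[𝔞_{compose f g}] = [𝔞_f] · [𝔞_g]` in `Cl(𝓞_K)`.
[cite: Cox2013, §7.B Thm. 7.7 and §3.A] -/
theorem mk0_formIdeal_compose (hK : IsImaginaryQuadratic K) {f g : BinQF}
    (hf : f.IsPosPrim (NumberField.discr K)) (hg : g.IsPosPrim (NumberField.discr K)) :
    ClassGroup.mk0 ⟨formIdeal b (compose (NumberField.discr K) f g),
        formIdeal_mem_nonZeroDivisors b hb (isPosPrim_compose b hb hω hK hf hg).a_pos⟩ =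
      ClassGroup.mk0 ⟨formIdeal b f, formIdeal_mem_nonZeroDivisors b hb hf.a_pos⟩ *
        ClassGroup.mk0 ⟨formIdeal b g, formIdeal_mem_nonZeroDivisors b hb hg.a_pos⟩ := by
  have hraw := isPosPrim_rawCompose b hb hω hf hg
  rw [← mk0_formIdeal_rawCompose b hb hω hf hg]
  exact (mk0_formIdeal_eq_of_properEquiv b hb hω hK hraw (properEquiv_reduce _)).symm

end Ring

end FormComposition

end Literature.Computability.Cryptography.Hallgren2005

end
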